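import Summits.ResolutionOfSingularities.ResolutionOfSingularities.Theorems.EquisingularLiftEquisingularLiftNatInCarrierStepExact
import HarnessLib

/-!
# [OURS · L1 W4.5(b) · EL♮(3) · T23-A″-S] EXACTNESS OF THE CARRIER ALONE along the two in-carrier point steps:
# `(St_τ 𝓢)·𝒪_{F₂} = St_υ (𝓢·𝒪_{F₁})` — the `𝓢`-alone forms of K7c `comap_strictTransformIdeal_carrierPair_eq_sup` (res-L1-w45b-stub-1, p533779)
# and of `comap_strictTransformIdeal_carrierPair_eq_sup_of_conePack` (res-L1-w45b-stub-1, p543070); input of the `…S` twins of (A)/(C)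

res-type-027 g18, object «A″-S UPSTAIRS TWINS» brick (S-1) (res-L1-w45b-plan-1 desk RULING R20 (iv) / DESK WORD 2026-08-28T08:15:46Z;
res-L1-w45b-stub-4's T23-A″ ENGINE WORD 16d03a46d50c8ccd §S). Crux `EquisingularLiftNatThree` = stmt-ResolutionOfSingularities-20148 (parent
`EquisingularLiftNat` = stmt-…-20038), route `EquisingularLift`, line `sections`. OURS; NOT a statement of any manuscript ([Hironaka2017] is a
candidate under adjudication, nothing of it is asserted); AI-written, weaker than expert review. No `sorry`; standard axioms; DEF-FREE.
`--supports stmt-ResolutionOfSingularities-20148 --as helper`; closes nothing by itself.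

WHAT. The plane-trace clause (ix) `𝓢.comap jG = 𝓘⟨closure S_d⟩` of `TCPlus.MemberS` (…NatSubchainSupplierInvSDefs) is transported through a
point step `τ` (blow-up of the in-carrier section `s`, downstairs the blow-up `υ` of the reduced point `x`, model square `j₂ ≫ τ = υ ≫ j`)
by the identity `(St_τ 𝓢).comap j₂ = St_υ (𝓢.comap j)` — «the special fibre of the strict transform of the carrier is the strict transform of
its special fibre; NO exceptional component». Both forms are ONE application of res-L1-w45b-stub-1's F⁺5 `comap_strictTransformIdeal_eq_of_model`
(…NatStrictTransformComap p519966) to `𝓢` with a LINEAR form (the carrier has order one along the section and is equimultiple at the special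
point) — literally the `e𝓢` line of the two cited pair theorems, isolated:
* `comap_strictTransformIdeal_carrier_eq_of_frame` — at ANY point of the section where a frame `c` of `(ker s)_{j x}` with `𝓢_{j x} = (c₀)` is
  given (`(c) + (ϖ) = 𝔪`, `ϖ ∉ (c)`, `𝒪/(c)` a domain): the CENTRED case reads its frame off the `CentredPackage`, form `T₀`;
* `comap_strictTransformIdeal_carrier_eq_of_regularPoint` — at a REGULAR point of the carrier curve (binders of res-L1-w45b-stub-4's
  `comap_strictTransformIdeal_cone_eq_of_regularPoint`, …NatConeExactRegularPoint, VERBATIM): a section frame (res-type-100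
  `exists_sectionFrame_forall_dim_at`), codimension two forces `h ∉ 𝔪²` for the carrier's local equation (…NatCodimTwoOrderOne), hence a
  linear form with a unit coefficient (…NatConePackDegreeOne), then F⁺5.
Downstream: `… = St_υ 𝓘⟨closure S_d⟩ = 𝓘⟨closure υ⁻¹(closure S_d ∖ {x})⟩` by res-L1-w45b-stub-4's `strictTransformIdeal_vanishingIdeal_eq` (p531318).

References: U. Görtz, T. Wedhorn, *Algebraic Geometry I* (2nd ed. 2020), Prop. 13.91 and (13.19) [GortzWedhorn2020]; H. Matsumura,
*Commutative Ring Theory* (1986), Thm. 14.2 [Matsumura1987]; The Stacks Project, Tag 0804 [StacksProject] — through the cited tree files.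
-/

set_option linter.dupNamespace false -- mandated namespace `Summit.<Summit>.<Problem>` of this single-conjunct summit
set_option linter.overlappingInstances false -- signatures carry `[IsDomain O] [IsDiscreteValuationRing O]`

noncomputable section

open CategoryTheory CategoryTheory.Limits AlgebraicGeometry TopologicalSpace Topology IsLocalRing
open Literature.AlgebraicGeometry.Resolution
open AlgebraicGeometry.Scheme.IdealSheafData

namespace Summit.ResolutionOfSingularities.ResolutionOfSingularities.Cruxes.EquisingularLiftNat.Sections

section CarrierExact

variable (O : Type) [CommRing O] [IsDomain O] [IsDiscreteValuationRing O] (k : Type) [Field k] (θ : O →+* k)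

/-- **Exactness of the carrier ALONE, frame form** (the `e𝓢` line of res-L1-w45b-stub-1's
`comap_strictTransformIdeal_carrierPair_eq_sup_of_conePack`, p543070). Model square `j : F₁ → X'` over `Spec θ` (`O` a DVR, uniformizer `ϖ`),
`τ : X₁ → X'` a blow-up of `J` with `J·𝒪_{F₁} = 𝔪_x` (`x` closed), `υ : F₂ → F₁` the blow-up of the reduced point, `j₂ ≫ τ = υ ≫ j`; at `j x` a
quasi-regular frame `c` of `J_{j x}` with `(c) + (ϖ) = 𝔪`, `ϖ ∉ (c)`, `𝒪/(c)` a domain, and an ideal sheaf `𝓢` with `𝓢_{j x} = (c₀)`. Then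
`(St_τ 𝓢)·𝒪_{F₂} = St_υ (𝓢·𝒪_{F₁})`. [cite: GortzWedhorn2020, Prop. 13.91 and (13.19)] [cite: StacksProject, Tag 0804] [OURS · L1 W4.5b ·
T23-A″-S] brick (S-1) toward the `…S` twins of the inner chain (stmt-ResolutionOfSingularities-20148); NOT a statement of the manuscript. -/
theorem comap_strictTransformIdeal_carrier_eq_of_frame (hθ : Function.Surjective θ)
    {X' X₁ F₁ F₂ : Scheme.{0}} (r' : X' ⟶ Spec (.of O)) [IsLocallyNoetherian X₁] [IsLocallyNoetherian F₂] [IsIntegral F₁]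
    [IsIntegral F₂] [IsLocallyNoetherian F₁] (j : F₁ ⟶ X') (t : F₁ ⟶ Spec (.of k))
    (hsq : IsPullback j t r' (Spec.map (CommRingCat.ofHom θ))) (J : X'.IdealSheafData)
    (τ : X₁ ⟶ X') (hτ : IsBlowup τ J) (υ : F₂ ⟶ F₁) (j₂ : F₂ ⟶ X₁) (hcomm : j₂ ≫ τ = υ ≫ j)
    (x : F₁) (hx : IsClosed ({x} : Set F₁)) (hυ : IsBlowup υ (vanishingIdeal ⟨{x}, hx⟩))
    (hJ : J.comap j = vanishingIdeal ⟨{x}, hx⟩) (ϖ : O) (hϖ : Irreducible ϖ)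
    {r : ℕ} (c : Fin (r + 1) → X'.presheaf.stalk (j x)) (hcJ : Ideal.span (Set.range c) = stalkIdeal J (j x))
    (hc : IsQuasiRegular c) [IsDomain (X'.presheaf.stalk (j x) ⧸ Ideal.span (Set.range c))]
    (hϖc : (X'.presheaf.Γgerm (j x)).hom (r'.appTop.hom ((Scheme.ΓSpecIso (.of O)).inv.hom ϖ)) ∉ Ideal.span (Set.range c))
    (h𝔪 : Ideal.span (Set.range c) ⊔
      Ideal.span {(X'.presheaf.Γgerm (j x)).hom (r'.appTop.hom ((Scheme.ΓSpecIso (.of O)).inv.hom ϖ))} =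
        maximalIdeal (X'.presheaf.stalk (j x)))
    (𝓢 : X'.IdealSheafData) (h𝓢 : stalkIdeal 𝓢 (j x) = Ideal.span {c 0}) :
    (strictTransformIdeal τ J 𝓢).comap j₂ = strictTransformIdeal υ (vanishingIdeal ⟨{x}, hx⟩) (𝓢.comap j) := by
  classical
  -- the frame downstairs generates `𝔪_x` (so the quotient is non-trivial) and stays quasi-regular
  have hc𝔪d := span_stalkMap_eq_maximalIdeal_of_model θ hθ r' j t hsq x ϖ
    (hϖ.maximalIdeal_eq ▸ Ideal.mem_span_singleton_self ϖ) c h𝔪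
  have hcq : IsQuasiRegular (fun i => (j.stalkMap x).hom (c i)) := isQuasiRegular_stalkMap_model O k θ hθ r' j t hsq x c hc ϖ hϖ hϖc
  haveI : Nontrivial (F₁.presheaf.stalk x ⧸ Ideal.span (Set.range fun i => (j.stalkMap x).hom (c i))) := by
    rw [hc𝔪d]; exact Ideal.Quotient.nontrivial_iff.mpr (maximalIdeal.isMaximal _).ne_top
  -- F⁺5 for `𝓢` with the linear form `T₀`
  exact comap_strictTransformIdeal_eq_of_model τ J 𝓢 hτ j υ j₂ hcomm x hx hυ hJ c hcJ hc
    (MvPolynomial.X 0) (MvPolynomial.isHomogeneous_X _ 0) (by rw [MvPolynomial.map_X]; exact MvPolynomial.X_ne_zero _)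
    (by rw [MvPolynomial.eval_X]; exact h𝓢) hcq
    (by rw [MvPolynomial.map_X, MvPolynomial.map_X]; exact MvPolynomial.X_ne_zero _)

/-- **Exactness of the carrier ALONE along the REGULAR in-carrier step** (the `e𝓢` line of K7c `comap_strictTransformIdeal_carrierPair_eq_sup`,
p533779; binders of res-L1-w45b-stub-4's `comap_strictTransformIdeal_cone_eq_of_regularPoint` VERBATIM). In the model square of the section
blow-up `τ` of `ker s` over the point blow-up `υ` of `x`, for an in-carrier pair `(𝓢, K)` (`𝓢 ⊔ K ≤ ker s`) with principal stalks at `j x` and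
`𝒪_{X′,j x}/(𝓢 ⊔ K)` regular of codimension `2`: `(St_τ 𝓢)·𝒪_{F₂} = St_υ (𝓢·𝒪_{F₁})`. [cite: GortzWedhorn2020, Prop. 13.91]
[cite: Matsumura1987, Thm. 14.2] [OURS · L1 W4.5b · T23-A″-S] brick (S-1) toward the `…S` twins of the inner chain
(stmt-ResolutionOfSingularities-20148); NOT a statement of the manuscript. -/
theorem comap_strictTransformIdeal_carrier_eq_of_regularPoint (hθ : Function.Surjective θ) {X' X₁ F₁ F₂ : Scheme.{0}}
    (r' : X' ⟶ Spec (.of O)) [IsSeparated r'] [IsLocallyNoetherian X₁] [IsLocallyNoetherian F₂] [IsIntegral F₁] [IsIntegral F₂]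
    [IsLocallyNoetherian F₁] (j : F₁ ⟶ X') (t : F₁ ⟶ Spec (.of k))
    (hsq : IsPullback j t r' (Spec.map (CommRingCat.ofHom θ)))
    (s : Spec (.of O) ⟶ X') (hs : s ≫ r' = 𝟙 _) (τ : X₁ ⟶ X') (hτ : IsBlowup τ s.ker)
    (υ : F₂ ⟶ F₁) (j₂ : F₂ ⟶ X₁) (hcomm : j₂ ≫ τ = υ ≫ j) (x : F₁) (hx : IsClosed ({x} : Set F₁))
    (hυ : IsBlowup υ (vanishingIdeal ⟨{x}, hx⟩)) (hJ : s.ker.comap j = vanishingIdeal ⟨{x}, hx⟩)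
    (hsx : s (closedPoint O) = j x) (hreg : IsRegularLocalRing (X'.presheaf.stalk (j x))) (ϖ : O) (hϖ : Irreducible ϖ)
    -- the in-carrier pair
    (𝓢 K : X'.IdealSheafData) (hle : 𝓢 ⊔ K ≤ s.ker) (h𝓢p : (stalkIdeal 𝓢 (j x)).IsPrincipal)
    (hKp : (stalkIdeal K (j x)).IsPrincipal)
    (hDreg : IsRegularLocalRing (X'.presheaf.stalk (j x) ⧸ stalkIdeal (𝓢 ⊔ K) (j x)))
    (hDdim : ringKrullDim (X'.presheaf.stalk (j x) ⧸ stalkIdeal (𝓢 ⊔ K) (j x)) + 2 =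
      ringKrullDim (X'.presheaf.stalk (j x))) :
    (strictTransformIdeal τ s.ker 𝓢).comap j₂ = strictTransformIdeal υ (vanishingIdeal ⟨{x}, hx⟩) (𝓢.comap j) := by
  classical
  haveI := hreg
  have hϖO : ϖ ∈ maximalIdeal O := by rw [hϖ.maximalIdeal_eq]; exact Ideal.mem_span_singleton_self ϖ
  -- (1) a section frame at `j x`
  obtain ⟨n, c, θR, hcI, hc, hdom, -, h𝔪, hϖc, -⟩ := exists_sectionFrame_forall_dim_at O r' s hs (j x) hsx hreg ϖ hϖ
  haveI := hdom
  have hc𝔪 : ∀ i, c i ∈ maximalIdeal (X'.presheaf.stalk (j x)) := fun i => by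
    rw [← h𝔪]; exact Ideal.mem_sup_left (Ideal.subset_span ⟨i, rfl⟩)
  have hI𝔪 : Ideal.span (Set.range c) ≤ maximalIdeal _ := Ideal.span_le.mpr (by rintro _ ⟨i, rfl⟩; exact hc𝔪 i)
  -- (2) local equations `h`, `f`
  obtain ⟨h, hh⟩ := h𝓢p.principal
  obtain ⟨f, hf⟩ := hKp.principal
  change stalkIdeal 𝓢 (j x) = Ideal.span {h} at hh
  change stalkIdeal K (j x) = Ideal.span {f} at hf
  have hsum : stalkIdeal (𝓢 ⊔ K) (j x) = Ideal.span {h} ⊔ Ideal.span {f} := by rw [stalkIdeal_sup, hh, hf]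
  have h𝓢le : stalkIdeal 𝓢 (j x) ≤ Ideal.span (Set.range c) := hcI ▸ stalkIdeal_mono (le_sup_left.trans hle) (j x)
  have hKle : stalkIdeal K (j x) ≤ Ideal.span (Set.range c) := hcI ▸ stalkIdeal_mono (le_sup_right.trans hle) (j x)
  have hhc : h ∈ Ideal.span (Set.range c) := h𝓢le (hh ▸ Ideal.mem_span_singleton_self h)
  have hfc : f ∈ Ideal.span (Set.range c) := hKle (hf ▸ Ideal.mem_span_singleton_self f)
  have hhm : h ∈ maximalIdeal _ := hI𝔪 hhc
  have hfm : f ∈ maximalIdeal _ := hI𝔪 hfc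
  -- (3) codimension two forces order one for the carrier's equation
  haveI : IsRegularLocalRing (X'.presheaf.stalk (j x) ⧸ (Ideal.span {h} ⊔ Ideal.span {f})) := by rw [← hsum]; exact hDreg
  have hdim' : ringKrullDim (X'.presheaf.stalk (j x) ⧸ (Ideal.span {h} ⊔ Ideal.span {f})) + 2 =
      ringKrullDim (X'.presheaf.stalk (j x)) := by rw [← hsum]; exact hDdim
  obtain ⟨hh2, -⟩ := notMem_sq_of_isRegularLocalRing_quotient_codim_two hhm hfm hdim'
  -- (4) the order-one cone pack of the carrier
  have hg : Ideal.span (Set.range fun i => (j.stalkMap x).hom (c i)) ≠ ⊤ := by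
    rw [span_stalkMap_eq_maximalIdeal_of_model θ hθ r' j t hsq x ϖ hϖO c h𝔪]
    exact (maximalIdeal.isMaximal _).ne_top
  obtain ⟨Φh, hΦh1, hΦhev, hΦhc, hΦhbar⟩ := exists_linearForm_conePack c hc𝔪 hhc hh2 (j.stalkMap x).hom hg
  have hcbar : IsQuasiRegular (fun i => (j.stalkMap x).hom (c i)) :=
    isQuasiRegular_stalkMap_model O k θ hθ r' j t hsq x c hc ϖ hϖ hϖc
  -- (5) F⁺5 for `𝓢`
  exact comap_strictTransformIdeal_eq_of_model τ s.ker 𝓢 hτ j υ j₂ hcomm x hx hυ hJ c hcI hc Φh hΦh1 hΦhc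
    (by rw [hΦhev]; exact hh) hcbar hΦhbar

end CarrierExact

end Summit.ResolutionOfSingularities.ResolutionOfSingularities.Cruxes.EquisingularLiftNat.Sections

end
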